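import Mathlib.Analysis.CStarAlgebra.Matrix
import Mathlib.Analysis.SpecialFunctions.Log.Basic
import Mathlib.Topology.Order.Basic
import Literature.MathematicalPhysics.QuantumLattice.FinDimSpectrum
import HarnessLib

/-!
# The approximating Hamiltonian method (Bogoliubov Jr.–Brankov–Zagrebnov–Kurbatov–Tonchev), named fact

The **approximating Hamiltonian theorem** for an ATTRACTIVE separable (BCS-type) interaction,
vendored AS PRINTED in the account of Bru–de Siqueira Pedra, *Non-cooperative equilibria of Fermi
systems with long range interactions*, Mem. AMS 224 (2013) no. 1052, Appendix "The approximating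
Hamiltonian method", conditions (A1)–(A5) and Theorem 107 (= Bogolyubov Jr.–Brankov–Zagrebnov–
Kurbatov–Tonchev, Russ. Math. Surveys 39:6 (1984) 1–50), specialised to ONE attractive channel.

Printed setting (Bru–Pedra, loc. cit.): `H_Λ := T_Λ + |Λ|⁻¹ Σ_{k=1}^{N} γ_k (U_k + iU'_k)^* (U_k + iU'_k)`
with `γ_k = -1` for `k ≤ n`, `γ_k = +1` for `n < k ≤ N`; the finite-volume pressure
`p[H_Λ] := (β|Λ|)⁻¹ ln Trace e^{-βH_Λ}`; approximating Hamiltonians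
`H_Λ(c₋, c₊) := T_Λ − Σ_{k≤n} (c̄_k (U_k+iU'_k) + c_k (U_k+iU'_k)^*) + Σ_{k>n} (…)`; approximating
free-energy density `f_{H,Λ}(c₋, c₊) := −|c₊|² + |c₋|² − p[H_Λ(c₋, c₊)]`; conditions
(A1) `|ln Trace e^{-βT_Λ}| ≤ β|Λ|C₀`, (A2) `‖(U_k+iU'_k)^#‖ ≤ C₁|Λ|`, (A3) commutator bounds
`‖[U^#, U^#]‖ ≤ |Λ|C₂`, `‖[U^#,[U^#,U]]‖ ≤ |Λ|C₃`, `‖[U^#,[U,T_Λ]]‖ ≤ |Λ|C₄`, (A4) the ergodicity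
condition `lim |Λ|⁻² (⟨U^*U⟩ − |⟨U⟩|²) = 0` in the Gibbs state of the approximating Hamiltonian,
for all `c₋`. **Theorem 107.** "Under assumptions (A1)–(A4) we obtain: (i) … there is `d₋ ∈ ℂⁿ`
such that `inf_{c₋} {sup_{c₊} f_{H,Λ}(c₋,c₊)} = f_{H,Λ}(d₋, r₊(d₋))`. (ii) In the thermodynamic limit
`lim {p[H_Λ] + f_{H,Λ}(d₋, r₊(d₋))} = 0` …".

Specialisation recorded here: `n = 1` attractive channel and no repulsive channel (take `N = 2`
with `U₂ = 0`, for which every condition and the gap equation are trivial and `r₊ = 0`), `U' = 0`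
absorbed into a single complex matrix `U`; the Hilbert space of the box is finite-dimensional
(matrices `Matrix (Fin d) (Fin d) ℂ`, the case of lattice fermions/spins in finite volume) and the
boxes are an abstract sequence `l ↦ (d l, vol l)` with `vol l → ∞` (only `|Λ|` enters the printed
statement and proof). Then `f_{H,Λ}(c) = |c|² − p[H_Λ(c)]` and Theorem 107 reads: there are
minimisers `d_l` of `c ↦ |c|² − p[H_l(c)]`, and `p[H_l] − (p[H_l(d_l)] − |d_l|²) → 0`.

Why this file: the Hubbard routes `ThermalWedge` (support `TwApproximatingHamiltonian`, hard half),
`DeformationLadder` (`ApproximatingHamiltonianGC`), `JosephsonMirror`, `IntrinsicLargeN` all rest on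
this theorem ("a Literature fact to vendor first"); with `T = hubbardTorusWith 2 L 1 U μ` (matrix of
the Hubbard Hamiltonian), `U = √g · pairField dWaveFormFactor L`, `vol = L²`, the model below is the
d-wave-seeded Hubbard torus `hubbardTorusWith − (g/L²)·pairFieldᴴ pairField` and `H_l(c)` with
`c = h/√g` real is the source Hamiltonian `dWaveSourceTorus L U μ h`, `|c|² = h²/g`.
Consumers take `(hAHM : bogoliubovJr_approximatingHamiltonian_attractive)` and must discharge
(A1)–(A4) for their model — (A4) (ergodicity of the pair field in the SOURCED Gibbs state) is a
genuine hypothesis, not automatic; Bru–Pedra's own variational theorem (op. cit. Thm 2.12ff, for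
their Banach space of long-range models) avoids (A4) but needs their infinite-volume framework,
which the tree does not have — deliberately NOT vendored here.

Vocabulary: `Matrix.partitionFn`, `Matrix.gibbsState` (tree, `FinDimSpectrum.lean`); operator norm
= the `L²`-operator norm scope `Matrix.Norms.L2Operator` (as in `FinDimSpectrum.lean`).
-/

noncomputable section

namespace Literature.MathematicalPhysics.QuantumLattice

open Filter
open scoped Matrix Matrix.Norms.L2Operator ComplexOrder Topology

namespace AHM

/-- The finite-volume pressure `p[H] := (β|Λ|)⁻¹ ln Trace e^{-βH}` of Bru–Pedra 2013, Appendix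
"The approximating Hamiltonian method" (real part of the tree's complex `Matrix.partitionFn`,
which is real and positive for Hermitian `H`, `Matrix.partitionFn_pos`).
[cite: BruPedra2013, Appendix: The approximating Hamiltonian method] -/
def pressure (β vol : ℝ) {d : ℕ} (H : Matrix (Fin d) (Fin d) ℂ) : ℝ :=
  Real.log (Matrix.partitionFn β H).re / (β * vol)

/-- The model Hamiltonian with ONE attractive separable channel,
`H_Λ := T_Λ − |Λ|⁻¹ U^* U` (Bru–Pedra 2013, Appendix, display defining `H_Λ`, with `N = n = 1`
effective, `γ₁ = −1`, `U' = 0`). [cite: BruPedra2013, Appendix: The approximating Hamiltonian method] -/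
def model {d : ℕ} (T U : Matrix (Fin d) (Fin d) ℂ) (vol : ℝ) : Matrix (Fin d) (Fin d) ℂ :=
  T - ((vol⁻¹ : ℝ) : ℂ) • (Uᴴ * U)

/-- The approximating Hamiltonian `H_Λ(c) := T_Λ − (c̄ U + c U^*)` of the attractive channel
(Bru–Pedra 2013, Appendix, display defining `H_Λ(c₋, c₊)` with no `+` components).
[cite: BruPedra2013, Appendix: The approximating Hamiltonian method] -/
def approx {d : ℕ} (T U : Matrix (Fin d) (Fin d) ℂ) (c : ℂ) : Matrix (Fin d) (Fin d) ℂ :=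
  T - ((starRingEnd ℂ c) • U + c • Uᴴ)

end AHM

/-- **The approximating Hamiltonian theorem, attractive single channel** (Bogolyubov Jr.–Brankov–
Zagrebnov–Kurbatov–Tonchev 1984, as stated in Bru–de Siqueira Pedra, Mem. AMS 224 (2013),
Appendix "The approximating Hamiltonian method", Theorem 107 (i)–(ii) with conditions (A1)–(A4)),
for a sequence of finite-dimensional boxes `l ↦ Matrix (Fin (d l)) (Fin (d l)) ℂ` of volumes
`vol l → ∞`, a Hermitian "kinetic" part `T l` and one separable attractive channel `U l`:
IF (A1) `|ln Tr e^{-β T_l}| ≤ β·vol_l·C₀`, (A2) `‖U_l‖ ≤ C₁·vol_l` (hence also `‖U_l^*‖`),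
(A3) `‖[U_l, U_l^*]‖ ≤ vol_l·C₂`, `‖[A,[B,U_l]]‖ ≤ vol_l·C₃` and `‖[A,[U_l,T_l]]‖ ≤ vol_l·C₄` for
`A, B ∈ {U_l, U_l^*}`, and (A4) for every `c ∈ ℂ` the pair fluctuation
`vol_l⁻² (⟨U_l^* U_l⟩_c − |⟨U_l⟩_c|²) → 0` in the Gibbs state `⟨·⟩_c` of `H_l(c) = T_l − (c̄U_l + cU_l^*)`
at inverse temperature `β`, THEN (i) for every `l` the approximating free energy
`c ↦ |c|² − p[H_l(c)]` attains its infimum at some `d_l ∈ ℂ`, and (ii)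
`p[T_l − vol_l⁻¹ U_l^*U_l] − (p[H_l(d_l)] − |d_l|²) → 0` as `l → ∞`, i.e. the pressure of the model
equals `sup_c (p[H_l(c)] − |c|²)` in the thermodynamic limit.
Specialisation of the printed `N`-channel statement (`n = 1`; repulsive channels absent — formally
`N = 2`, `U₂ = 0`); finite-dimensional Hilbert spaces; boxes abstracted to `(d l, vol l)`.
Grounds the hard half of `Summit.HubbardSuperconductivity.HubbardSuperconductivity.Theses.ThermalWedge.TwApproximatingHamiltonian`
(with `T = hubbardTorusWith 2 L 1 U μ`, `U = √g·pairField dWaveFormFactor L`, `vol = L²`, `c = h/√g`)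
modulo the consumer's verification of (A1)–(A4) for that model.
[cite: BruPedra2013, Appendix: The approximating Hamiltonian method, Theorem 107 and (A1)–(A4)]
[cite: BogolyubovJrEtAl1984, Theorem (ii) of the approximating Hamiltonian method] -/
def bogoliubovJr_approximatingHamiltonian_attractive : Prop :=
  ∀ (d : ℕ → ℕ) (vol : ℕ → ℝ) (T U : (l : ℕ) → Matrix (Fin (d l)) (Fin (d l)) ℂ)
    (β C₀ C₁ C₂ C₃ C₄ : ℝ),
    0 < β → (∀ l, 0 < vol l) → Tendsto vol atTop atTop → (∀ l, (T l).IsHermitian) →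
    -- (A1) finite-volume pressure of `T`
    (∀ l, |Real.log (Matrix.partitionFn β (T l)).re| ≤ β * vol l * C₀) →
    -- (A2) `‖U^#‖ ≤ C₁ |Λ|`
    (∀ l, ‖U l‖ ≤ C₁ * vol l) →
    -- (A3) commutator bounds
    (∀ l, ‖U l * (U l)ᴴ - (U l)ᴴ * U l‖ ≤ vol l * C₂) →
    (∀ l, ∀ A ∈ ({U l, (U l)ᴴ} : Set (Matrix (Fin (d l)) (Fin (d l)) ℂ)),
      ∀ B ∈ ({U l, (U l)ᴴ} : Set (Matrix (Fin (d l)) (Fin (d l)) ℂ)),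
        ‖A * (B * U l - U l * B) - (B * U l - U l * B) * A‖ ≤ vol l * C₃) →
    (∀ l, ∀ A ∈ ({U l, (U l)ᴴ} : Set (Matrix (Fin (d l)) (Fin (d l)) ℂ)),
        ‖A * (U l * T l - T l * U l) - (U l * T l - T l * U l) * A‖ ≤ vol l * C₄) →
    -- (A4) ergodicity of the channel in the approximating Gibbs states
    (∀ c : ℂ, Tendsto (fun l => ((Matrix.gibbsState β (AHM.approx (T l) (U l) c) ((U l)ᴴ * U l)).re
        - ‖Matrix.gibbsState β (AHM.approx (T l) (U l) c) (U l)‖ ^ 2) / vol l ^ 2) atTop (𝓝 0)) →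
    -- Theorem 107 (i) (existence of a minimiser of the approximating free energy) and (ii)
    ∃ dmin : ℕ → ℂ,
      (∀ l, ∀ c : ℂ, AHM.pressure β (vol l) (AHM.approx (T l) (U l) c) - ‖c‖ ^ 2 ≤
          AHM.pressure β (vol l) (AHM.approx (T l) (U l) (dmin l)) - ‖dmin l‖ ^ 2) ∧
      Tendsto (fun l => AHM.pressure β (vol l) (AHM.model (T l) (U l) (vol l))
          - (AHM.pressure β (vol l) (AHM.approx (T l) (U l) (dmin l)) - ‖dmin l‖ ^ 2)) atTop (𝓝 0)

end Literature.MathematicalPhysics.QuantumLattice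

end
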